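import Mathlib
import HarnessLib
import Literature.Probability.Process.RootedHardCoreVague

/-!
# Ergodic reduction for the crux `AperiodicFrustratedLawGap` — the re-rooting-invariant σ-algebra

Route `FrustratedLawDichotomy`, crux `AperiodicFrustratedLawGap` (item `stmt-AtomisticToContinuum-27623`),
registered stub `stub_ergodicReduction` (skeleton `dd3251ad731e`); companion of
`FrustratedLawDichotomyAperiodicFrustratedLawGapErgodic{Reduction,Pullback,Campbell,Restrict}`.  Step D2 of
the ergodic-decomposition plan recorded in `…ErgodicReduction`: the σ-algebra `𝓘` of measurable sets of
rooted hard-core configurations invariant under re-rooting (`S ∈ B ↔ S - y ∈ B` for every point `y ∈ S`),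
on which the conditional laws `condExpKernel Q 𝓘` of step D3 are taken.  Stated WITHOUT introducing a
definition (existence of a `MeasurableSpace` structure with exactly these measurable sets):

* `exists_invariant_measurableSpace` — the invariant measurable sets form a σ-algebra `𝓘 ≤ borel`;
* `apply_reroot_eq_of_measurable_invariant` — a real function measurable for such a σ-algebra is exactly
  invariant under re-rooting (its level sets are invariant events);
* `measure_eq_zero_or_compl_iff` — restating triviality on `𝓘` ("ergodicity", the clause used in
  `…ErgodicPullback.ergodic_map_toMeasure`) through the σ-algebra.

`[folklore]`.
-/

noncomputable section

namespace Summit.AtomisticToContinuum.Crystallization.Theorems.FrustratedLawDichotomyErgodicReduction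

open MeasureTheory Set Filter
open Literature.Probability.Process (LocalConfig)
open Literature.Probability.Process.LocalConfig (RootedHardCoreConfig)

variable {E : Type*} [NormedAddCommGroup E] {δ : ℝ}

/-- **The re-rooting-invariant σ-algebra exists.**  On the space of rooted `δ`-hard-core configurations
(with any measurable structure, e.g. its Borel σ-algebra) there is a σ-algebra `𝓘` whose measurable sets
are exactly the measurable sets `B` invariant under re-rooting at every point
(`S ∈ B ↔ S.reroot y _ ∈ B` for all `y ∈ S`); in particular `𝓘 ≤` the given σ-algebra. [folklore] -/
theorem exists_invariant_measurableSpace [m₀ : MeasurableSpace (RootedHardCoreConfig E δ)] :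
    ∃ m : MeasurableSpace (RootedHardCoreConfig E δ), m ≤ m₀ ∧
      ∀ B : Set (RootedHardCoreConfig E δ), MeasurableSet[m] B ↔
        (MeasurableSet[m₀] B ∧ ∀ (S : RootedHardCoreConfig E δ) (y : E)
          (hy : y ∈ ((S.1 : LocalConfig E) : Set E)), S ∈ B ↔ S.reroot y hy ∈ B) := by
  refine ⟨{ MeasurableSet' := fun B => MeasurableSet[m₀] B ∧ ∀ (S : RootedHardCoreConfig E δ) (y : E)
              (hy : y ∈ ((S.1 : LocalConfig E) : Set E)), S ∈ B ↔ S.reroot y hy ∈ B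
            measurableSet_empty := ⟨MeasurableSet.empty, fun S y hy => by simp⟩
            measurableSet_compl := fun B hB => ⟨hB.1.compl, fun S y hy => not_congr (hB.2 S y hy)⟩
            measurableSet_iUnion := fun f hf => ⟨MeasurableSet.iUnion fun i => (hf i).1,
              fun S y hy => by
                simp only [mem_iUnion]
                exact exists_congr fun i => (hf i).2 S y hy⟩ }, fun B hB => hB.1, fun B => Iff.rfl⟩

/-- **Functions measurable for the invariant σ-algebra are invariant.**  If `𝓘` is a σ-algebra of
re-rooting-invariant sets and `f` is `𝓘`-measurable into a space with measurable points, then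
`f (S.reroot y _) = f S` for every configuration `S` and every point `y ∈ S` (the level set of `f`
through `S` is an invariant event containing `S`). [folklore] -/
theorem apply_reroot_eq_of_measurable_invariant {β : Type*} [MeasurableSpace β]
    [MeasurableSingletonClass β] {m : MeasurableSpace (RootedHardCoreConfig E δ)}
    (hm : ∀ B : Set (RootedHardCoreConfig E δ), MeasurableSet[m] B →
      ∀ (S : RootedHardCoreConfig E δ) (y : E) (hy : y ∈ ((S.1 : LocalConfig E) : Set E)),
        S ∈ B ↔ S.reroot y hy ∈ B)
    {f : RootedHardCoreConfig E δ → β} (hf : Measurable[m] f) (S : RootedHardCoreConfig E δ) (y : E)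
    (hy : y ∈ ((S.1 : LocalConfig E) : Set E)) :
    f (S.reroot y hy) = f S := by
  have h := (hm (f ⁻¹' {f S}) (hf (measurableSet_singleton (f S))) S y hy).1 rfl
  exact h

/-- **Triviality on the invariant σ-algebra.**  For a σ-algebra `𝓘` whose measurable sets are exactly the
measurable re-rooting-invariant sets, a law `Q` is trivial on `𝓘` (`Q B = 0 ∨ Q Bᶜ = 0` for `B ∈ 𝓘`) iff it
is trivial on every measurable re-rooting-invariant set — the ergodicity clause of
`…ErgodicPullback.ergodic_map_toMeasure`. [folklore] -/
theorem measure_eq_zero_or_compl_iff [m₀ : MeasurableSpace (RootedHardCoreConfig E δ)]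
    {m : MeasurableSpace (RootedHardCoreConfig E δ)}
    (hm : ∀ B : Set (RootedHardCoreConfig E δ), MeasurableSet[m] B ↔
      (MeasurableSet[m₀] B ∧ ∀ (S : RootedHardCoreConfig E δ) (y : E)
        (hy : y ∈ ((S.1 : LocalConfig E) : Set E)), S ∈ B ↔ S.reroot y hy ∈ B))
    (Q : Measure[m₀] (RootedHardCoreConfig E δ)) :
    (∀ B : Set (RootedHardCoreConfig E δ), MeasurableSet[m] B → Q B = 0 ∨ Q Bᶜ = 0) ↔
      ∀ B : Set (RootedHardCoreConfig E δ), MeasurableSet[m₀] B →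
        (∀ (S : RootedHardCoreConfig E δ) (y : E) (hy : y ∈ ((S.1 : LocalConfig E) : Set E)),
          S ∈ B ↔ S.reroot y hy ∈ B) → Q B = 0 ∨ Q Bᶜ = 0 :=
  ⟨fun h B hB hinv => h B ((hm B).2 ⟨hB, hinv⟩), fun h B hB => h B ((hm B).1 hB).1 ((hm B).1 hB).2⟩

end Summit.AtomisticToContinuum.Crystallization.Theorems.FrustratedLawDichotomyErgodicReduction

end
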